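import Literature.MathematicalPhysics.QuantumLattice.TranslationInvariantGroundStatesAreMeanEnergyMinimisers
import HarnessLib

/-!
# The ground-state condition and the mean energy of a lattice fermion system do not depend on the
# range parameter (Araki–Moriya Thm. 5.7 / Bratteli–Robinson II Thm. 6.2.4: `δ(A) = i[H(I), A]` for
# every region `I` containing the `R`-neighbourhood of the support of `A`)

Topic `Literature/MathematicalPhysics/QuantumLattice`; namespace
`Literature.MathematicalPhysics.QuantumLattice` (the file path). Vocabulary of `InfVolFermionState.lean` §6:
the derivation `FermionInteraction.derivation Ψ R Λ A = i[H_{thicken Λ R}, ΓA]`, the ground-state condition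
`InfVolFermionState.IsGroundState ω Ψ R`, the mean energy `InfVolFermionState.meanEnergy Ψ R ω = Re ω(E_Ψ^{(R)})`
and `IsMeanEnergyMinimiser Ψ R ω` all carry the bookkeeping parameter `R` (the radius of the window in which
commutators and the mean-energy observable are formed). The docstrings of `InfVolFermionState.lean` record
that for an interaction of range `≤ R` nothing depends on `R`; the spin-system twin is the discharged fact
`derivation_indep_of_range` (`InfiniteVolumeStatesDerivationProofs.lean`). This file PROVES the fermionic
statements, for EVEN interactions (graded locality), so that rows and theorems stated at one admissible
`R` transfer to any other:

* §1 `FermionInteraction.localHamiltonian_commutator_fermionEmbed_eq_of_thicken_subset` — **the commutator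
  with a local observable sees only the `R`-neighbourhood**: for `Ψ` even of range `R`, `A ∈ 𝔄_Λ` and every
  finite `Λ' ⊇ thicken Λ R`,
  `[H^Ψ_{Λ'}, Γ_{Λ⊆Λ'} A] = Γ_{thicken Λ R ⊆ Λ'} [H^Ψ_{thicken Λ R}, Γ A]`
  (the terms of `H_{Λ'}` not inside `thicken Λ R` are either disjoint from `thicken Λ R`, or — having
  diameter `≤ R` and a point outside `thicken Λ R` — disjoint from `Λ`; even elements of regions disjoint
  from `Λ` commute with `Γ𝔄_Λ`). Model-free form of the tree's
  `hubbardTTPrime_localHamiltonian_commutator_fermionEmbed_eq`.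
* §2 `InfVolFermionState.isGroundState_iff_of_le` — **`IsGroundState ω Ψ R ↔ IsGroundState ω Ψ R'`** for
  `R ≤ R'` and `Ψ` even of range `R`; the rows in every window: stationarity
  `IsGroundState.expect_commutator_localHamiltonian_eq_zero_of_thicken_subset` and the Bratteli–Robinson
  inequality `IsGroundState.re_expect_conj_commutator_nonneg_of_thicken_subset` in any `Λ' ⊇ thicken Λ R`.
* §3 `InfVolFermionState.meanEnergy_eq_of_le_of_hasFiniteRange` — **`e_Ψ^{(R')}(ω) = e_Ψ^{(R)}(ω)`** for `R ≤ R'` and `Ψ` of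
  range `R` (any state: the extra terms of `E_Ψ^{(R')}` vanish), hence
  `isMeanEnergyMinimiser_iff_of_le` and `tiGroundEnergyDensity_eq_of_le`.

Everything is PROVED; no definition, no named fact.

## References

* H. Araki, H. Moriya, Rev. Math. Phys. 15 (2003) 93, Thm. 5.7 and §6 (`δ_Φ(A) = i[H(I), A]` on `𝔄(I₀)`
  for every `I ⊇` the `R`-neighbourhood of `I₀`). [cite: ArakiMoriya2003, Thm. 5.7 and §6]
* O. Bratteli, D. W. Robinson, *Operator Algebras and Quantum Statistical Mechanics 2* (1997), Thm. 6.2.4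
  and eq. (6.2.9). [cite: BratteliRobinsonII1997, Thm. 6.2.4]
* O. Bratteli, A. Kishimoto, D. W. Robinson, Commun. Math. Phys. 64 (1978) 41, §3 (the mean energy
  `H_Φ(ω)`). [cite: BratteliKishimotoRobinson1978, §3]
-/

noncomputable section

namespace Literature.MathematicalPhysics.QuantumLattice

open Matrix Finset HubbardWave0 Literature.Probability.LatticeModels
open scoped ComplexOrder

variable {d : ℕ}

/-! ### §1. The commutator with a local observable sees only the `R`-neighbourhood -/

namespace FermionInteraction

variable {Ψ : FermionInteraction d} {R : ℝ}

/-- **Finite range, contrapositive form**: a region carrying a nonzero term that meets `Λ` lies in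
`thicken Λ R`. [cite: BratteliRobinsonII1997, §6.2.1 (finite range)] -/
theorem HasFiniteRange.subset_thicken_of_not_disjoint (hR : Ψ.HasFiniteRange R) {X Λ : Finset (Site d)}
    (hX : Ψ.Φ X ≠ 0) (hd : ¬ Disjoint X Λ) : X ⊆ thicken Λ R := by
  obtain ⟨x, hxX, hxΛ⟩ := Finset.not_disjoint_iff.1 hd
  exact (hR.subset_thicken_singleton hX hxX).trans
    (thicken_subset_thicken_of_subset (Finset.singleton_subset_iff.2 hxΛ) R)

/-- **The terms crossing the boundary of the `R`-neighbourhood do not see `𝔄_Λ`**: for `Ψ` even of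
range `R` and `thicken Λ R ⊆ Λ'`, the sum of the terms `Ψ X`, `X ⊆ Λ'`, `X ⊄ thicken Λ R`,
`X ∩ thicken Λ R ≠ ∅`, commutes with `Γ_{Λ⊆Λ'} A` for every `A ∈ 𝔄_Λ` (each such nonzero term has
diameter `≤ R` and a point outside `thicken Λ R`, hence misses `Λ`).
[cite: ArakiMoriya2003, Thm. 5.7 (proof)] -/
theorem commute_crossSum_fermionEmbed (hE : Ψ.IsEven) (hR : Ψ.HasFiniteRange R) {Λ Λ' : Finset (Site d)}
    (h : thicken Λ R ⊆ Λ') (A : FermionOp Λ) :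
    Commute (∑ X ∈ Λ'.powerset with (¬ X ⊆ thicken Λ R ∧ ¬ Disjoint X (thicken Λ R)),
        (if hX : X ⊆ Λ' then fermionEmbed (PolySite.incl hX) (Ψ.Φ X) else 0))
      (fermionEmbed (PolySite.incl ((subset_thicken Λ R).trans h)) A) := by
  refine Commute.sum_left _ _ _ fun X hX => ?_
  rw [Finset.mem_filter, Finset.mem_powerset] at hX
  rw [dif_pos hX.1]
  by_cases hzero : Ψ.Φ X = 0
  · rw [hzero, map_zero]
    exact Commute.zero_left _
  · refine Ψ.commute_fermionEmbed_apply_of_disjoint hE hX.1 _ ?_ A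
    by_contra hd
    exact hX.2.1 (hR.subset_thicken_of_not_disjoint hzero hd)

/-- **The commutator with a local observable sees only the `R`-neighbourhood** (Araki–Moriya Thm. 5.7:
`δ_Φ(A) = i[H(I), A]` for every `I` containing the `R`-neighbourhood of the support of `A`): for `Ψ` even
of range `R`, `A ∈ 𝔄_Λ` and every finite `Λ' ⊇ thicken Λ R`,
`H_{Λ'} ΓA − ΓA H_{Λ'} = Γ_{thicken Λ R ⊆ Λ'} (H_{thicken Λ R} ΓA − ΓA H_{thicken Λ R})`.
[cite: ArakiMoriya2003, Thm. 5.7 and §6] [cite: BratteliRobinsonII1997, Thm. 6.2.4, eq. (6.2.9)] -/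
theorem localHamiltonian_commutator_fermionEmbed_eq_of_thicken_subset (hE : Ψ.IsEven)
    (hR : Ψ.HasFiniteRange R) {Λ Λ' : Finset (Site d)} (h : thicken Λ R ⊆ Λ') (A : FermionOp Λ) :
    Ψ.localHamiltonian Λ' * fermionEmbed (PolySite.incl ((subset_thicken Λ R).trans h)) A -
        fermionEmbed (PolySite.incl ((subset_thicken Λ R).trans h)) A * Ψ.localHamiltonian Λ' =
      fermionEmbed (PolySite.incl h)
        (Ψ.localHamiltonian (thicken Λ R) * fermionEmbed (PolySite.incl (subset_thicken Λ R)) A -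
          fermionEmbed (PolySite.incl (subset_thicken Λ R)) A * Ψ.localHamiltonian (thicken Λ R)) := by
  have hA : fermionEmbed (PolySite.incl ((subset_thicken Λ R).trans h)) A =
      fermionEmbed (PolySite.incl h) (fermionEmbed (PolySite.incl (subset_thicken Λ R)) A) := by
    rw [fermionEmbed_fermionEmbed, PolySite.incl_trans]
  have hfar := (Ψ.commute_farSum_fermionEmbed hE h (fermionEmbed (PolySite.incl (subset_thicken Λ R)) A)).eq
  have hcross := (Ψ.commute_crossSum_fermionEmbed hE hR h A).eq
  rw [← hA] at hfar
  rw [Ψ.localHamiltonian_eq_fermionEmbed_add_far_add_cross h, add_mul, add_mul, mul_add, mul_add, hfar,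
    hcross, hA, map_sub, map_mul, map_mul]
  abel

end FermionInteraction

/-! ### §2. The ground-state condition at two admissible range parameters -/

namespace InfVolFermionState

variable {Ψ : FermionInteraction d} {R R' : ℝ} {ω : InfVolFermionState d}

/-- The defining expectation of `IsGroundState` at range parameter `R'` equals the one at `R ≤ R'`
(for `Ψ` even of range `R`): `ω((Γ'A)⋆ δ_{R'}(A)) = ω((ΓA)⋆ δ_R(A))`.
[cite: ArakiMoriya2003, Thm. 5.7 and §6] -/
theorem expect_conjTranspose_mul_derivation_eq_of_le (ω : InfVolFermionState d) (hE : Ψ.IsEven)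
    (hR : Ψ.HasFiniteRange R) (hRR' : R ≤ R') (Λ : Finset (Site d)) (A : FermionOp Λ) :
    ω.expect (thicken Λ R')
        ((fermionEmbed (PolySite.incl (subset_thicken Λ R')) A)ᴴ * Ψ.derivation R' Λ A) =
      ω.expect (thicken Λ R)
        ((fermionEmbed (PolySite.incl (subset_thicken Λ R)) A)ᴴ * Ψ.derivation R Λ A) := by
  have h : thicken Λ R ⊆ thicken Λ R' := thicken_mono Λ hRR'
  have hcomm := Ψ.localHamiltonian_commutator_fermionEmbed_eq_of_thicken_subset hE hR h A
  have hA : fermionEmbed (PolySite.incl (subset_thicken Λ R')) A =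
      fermionEmbed (PolySite.incl h) (fermionEmbed (PolySite.incl (subset_thicken Λ R)) A) := by
    rw [fermionEmbed_fermionEmbed, PolySite.incl_trans]
  rw [FermionInteraction.derivation, FermionInteraction.derivation, hA]
  rw [hA] at hcomm
  rw [hcomm, ← fermionEmbed_conjTranspose, ← map_smul, ← map_mul, ω.compatible h]

/-- **The ground-state condition does not depend on the range parameter**: for `Ψ` even of range `R`
and `R ≤ R'`, `ω.IsGroundState Ψ R ↔ ω.IsGroundState Ψ R'`.
[cite: ArakiMoriya2003, Thm. 5.7 and §6] [cite: BratteliRobinsonII1997, Thm. 6.2.4] -/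
theorem isGroundState_iff_of_le (hE : Ψ.IsEven) (hR : Ψ.HasFiniteRange R) (hRR' : R ≤ R') :
    ω.IsGroundState Ψ R ↔ ω.IsGroundState Ψ R' := by
  refine ⟨fun hgs Λ A => ?_, fun hgs Λ A => ?_⟩
  · rw [ω.expect_conjTranspose_mul_derivation_eq_of_le hE hR hRR' Λ A]
    exact hgs Λ A
  · rw [← ω.expect_conjTranspose_mul_derivation_eq_of_le hE hR hRR' Λ A]
    exact hgs Λ A

/-- A ground state at range parameter `R` is a ground state at every `R' ≥ R`.
[cite: ArakiMoriya2003, Thm. 5.7 and §6] -/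
theorem IsGroundState.of_le (hgs : ω.IsGroundState Ψ R) (hE : Ψ.IsEven) (hR : Ψ.HasFiniteRange R)
    (hRR' : R ≤ R') : ω.IsGroundState Ψ R' :=
  (isGroundState_iff_of_le hE hR hRR').1 hgs

/-- A ground state at range parameter `R' ≥ R` is a ground state at the range `R` of the interaction.
[cite: ArakiMoriya2003, Thm. 5.7 and §6] -/
theorem IsGroundState.of_ge (hgs : ω.IsGroundState Ψ R') (hE : Ψ.IsEven) (hR : Ψ.HasFiniteRange R)
    (hRR' : R ≤ R') : ω.IsGroundState Ψ R :=
  (isGroundState_iff_of_le hE hR hRR').2 hgs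

/-- **Stationarity in every window**: for a ground state of an even interaction of range `R`, every local
`B ∈ 𝔄_Λ` and every finite `Λ' ⊇ thicken Λ R`, `ω(H_{Λ'} ΓB − ΓB H_{Λ'}) = 0`.
[cite: BratteliRobinsonII1997, Prop. 5.3.19] [cite: ArakiMoriya2003, Thm. 5.7] -/
theorem IsGroundState.expect_commutator_localHamiltonian_eq_zero_of_thicken_subset
    (hgs : ω.IsGroundState Ψ R) (hE : Ψ.IsEven) (hR : Ψ.HasFiniteRange R) {Λ Λ' : Finset (Site d)}
    (h : thicken Λ R ⊆ Λ') (B : FermionOp Λ) :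
    ω.expect Λ' (Ψ.localHamiltonian Λ' * fermionEmbed (PolySite.incl ((subset_thicken Λ R).trans h)) B -
      fermionEmbed (PolySite.incl ((subset_thicken Λ R).trans h)) B * Ψ.localHamiltonian Λ') = 0 := by
  rw [Ψ.localHamiltonian_commutator_fermionEmbed_eq_of_thicken_subset hE hR h B, ω.compatible h]
  exact hgs.expect_commutator_localHamiltonian_eq_zero Λ B

/-- **The Bratteli–Robinson inequality in every window**: for a ground state of an even interaction of
range `R`, every local `A ∈ 𝔄_Λ` and every finite `Λ' ⊇ thicken Λ R`,
`Re ω((ΓA)⋆ (H_{Λ'} ΓA − ΓA H_{Λ'})) ≥ 0`.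
[cite: BratteliKishimotoRobinson1978, §1 (definition of τ-ground state)] [cite: ArakiMoriya2003, Thm. 5.7] -/
theorem IsGroundState.re_expect_conj_commutator_nonneg_of_thicken_subset (hgs : ω.IsGroundState Ψ R)
    (hE : Ψ.IsEven) (hR : Ψ.HasFiniteRange R) {Λ Λ' : Finset (Site d)} (h : thicken Λ R ⊆ Λ')
    (A : FermionOp Λ) :
    0 ≤ (ω.expect Λ' ((fermionEmbed (PolySite.incl ((subset_thicken Λ R).trans h)) A)ᴴ *
      (Ψ.localHamiltonian Λ' * fermionEmbed (PolySite.incl ((subset_thicken Λ R).trans h)) A -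
        fermionEmbed (PolySite.incl ((subset_thicken Λ R).trans h)) A * Ψ.localHamiltonian Λ'))).re := by
  have hA : fermionEmbed (PolySite.incl ((subset_thicken Λ R).trans h)) A =
      fermionEmbed (PolySite.incl h) (fermionEmbed (PolySite.incl (subset_thicken Λ R)) A) := by
    rw [fermionEmbed_fermionEmbed, PolySite.incl_trans]
  rw [Ψ.localHamiltonian_commutator_fermionEmbed_eq_of_thicken_subset hE hR h A, hA,
    ← fermionEmbed_conjTranspose, ← map_mul, ω.compatible h]
  exact hgs.re_expect_conj_commutator_nonneg Λ A

/-! ### §3. The mean energy at two admissible range parameters -/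

/-- **The mean energy does not depend on the range parameter**: for `Ψ` of range `R` and `R ≤ R'`,
`e_Ψ^{(R')}(ω) = e_Ψ^{(R)}(ω)` for every state `ω` (the regions `X ∋ 0` inside `thicken {0} R'` but not
inside `thicken {0} R` carry no term; the `HasFiniteRange` form of the tree's `meanEnergy_eq_of_le`, whose
hypothesis is the support condition itself). [cite: BratteliKishimotoRobinson1978, §3 (mean energy functional)] -/
theorem meanEnergy_eq_of_le_of_hasFiniteRange (ω : InfVolFermionState d) (hR : Ψ.HasFiniteRange R)
    (hRR' : R ≤ R') : ω.meanEnergy Ψ R' = ω.meanEnergy Ψ R := by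
  unfold meanEnergy
  rw [KrausPattern.expect_meanEnergyObs, KrausPattern.expect_meanEnergyObs,
    hR.sum_filter_mem_eq_sum_thicken_singleton _ (fun X hX => by rw [hX, map_zero, mul_zero])
      (thicken_mono _ hRR')]

/-- **Minimising the mean energy does not depend on the range parameter.**
[cite: BratteliKishimotoRobinson1978, Thm. 2 (condition 2)] -/
theorem isMeanEnergyMinimiser_iff_of_le (hR : Ψ.HasFiniteRange R) (hRR' : R ≤ R') :
    ω.IsMeanEnergyMinimiser Ψ R ↔ ω.IsMeanEnergyMinimiser Ψ R' := by
  unfold IsMeanEnergyMinimiser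
  simp_rw [meanEnergy_eq_of_le_of_hasFiniteRange _ hR hRR']

end InfVolFermionState

/-- **The translation-invariant ground-state energy density does not depend on the range parameter.**
[cite: BratteliKishimotoRobinson1978, Thm. 2 (condition 2)] -/
theorem FermionInteraction.tiGroundEnergyDensity_eq_of_le {Ψ : FermionInteraction d} {R R' : ℝ}
    (hR : Ψ.HasFiniteRange R) (hRR' : R ≤ R') :
    Ψ.tiGroundEnergyDensity R' = Ψ.tiGroundEnergyDensity R := by
  unfold FermionInteraction.tiGroundEnergyDensity
  simp_rw [InfVolFermionState.meanEnergy_eq_of_le_of_hasFiniteRange _ hR hRR']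

end Literature.MathematicalPhysics.QuantumLattice

end
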